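import Literature.Geometry.Riemannian.PerelmanEntropyCutoff
import HarnessLib

/-!
# Stub `helper_csEntropy_cutoff_le_of_integrableOn` (W4) of line `collapsed-ends-usc` (crux
# `EntropyRung.NoncompactShrinkerGap`, stmt-SmoothPoincare4-10868): Topping's Lemma 8.3.5 in
# compact-support `𝒲`-form on an arbitrary (possibly non-compact) Riemannian manifold

For a Riemannian metric `g` (any model with corners, any manifold `M`, no compactness), a
continuous `S : M → ℝ`, `τ > 0`, `r > 0`, `p ∈ M`, and a smooth compactly supported cut-off `χ`
with `0 ≤ χ ≤ 1`, `χ = 1` on `B₂ = B(p, r/2)`, `tsupport χ ⊆ B₁ = B(p, r)`, `|∇χ|²_g ≤ K`,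
`Vol B₁ < ∞` and `|S|` integrable on `B₁`, the compact-support `𝒲`-type functional
`F_τ(χ) = (∫ (τ (S χ² + 4|∇χ|²) − χ² log χ²) dV) / Z + log Z + log (4πτ)^{-n/2} − n`, `Z = ∫ χ² dV`,
satisfies
`F_τ(χ) ≤ 4τK (V₁ − V₂)/V₂ + (τ/V₂) ∫_{B₁} |S| dV + log (V₁ / (4πτ)^{n/2}) − n`,
`V₁ = Vol B₁`, `V₂ = Vol B₂` — the four Terms of Topping's proof of Lemma 8.3.5 (Topping 2006,
§8.3) for the density `χ²/Z`: Term 1 `∫ 4τ|∇χ|² ≤ 4τK (V₁ − V₂)` (`∇χ = 0` on the open ball `B₂`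
and off `tsupport χ`), Term 2 `∫ τ S χ² ≤ τ ∫_{B₁} |S|`, both divided by `Z ≥ V₂`; Term 3 Jensen's
inequality for `−y log y` on `B₁` (`setIntegral_negMulLog_le_mul_log`):
`−(∫ χ² log χ²)/Z + log Z = ∫ −(χ²/Z) log (χ²/Z) ≤ log V₁`; Term 4 `log (4πτ)^{-n/2} = −log (4πτ)^{n/2}`.
This is the `δ = 0`, non-compact twin of `wEntropy_cutoffTest_le` / `muEntropy_le_of_cutoff`
(`Literature/Geometry/Riemannian/PerelmanEntropyCutoff.lean`); all integrands are continuous with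
compact support except `|∇χ|²` (bounded, supported in `B₁ ∖ B₂`; if the numerator is not integrable
its Bochner integral vanishes and the bound holds a fortiori) and `|S| 𝟙_{B₁}` (hypothesis).

The registered stub `helper_csEntropy_cutoff_le` (same statement WITHOUT the hypothesis
`IntegrableOn |S| B₁`) is not provable: on a ball of finite volume whose closure is not compact a
continuous `S` need not be integrable, the Bochner integral `∫_{B₁} |S|` is then `0`, while
`∫ τ S χ²/Z` is unbounded in `S`. Also proved here, for the positivity `V₂ > 0` without a
boundaryless model: the Riemannian measure charges nonempty open sets for ANY model with corners
(`riemannianVolume_pos_of_isOpen_corners`, `vol_ball_pos_corners`; the tree's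
`riemannianVolume_pos_of_isOpen` assumes `I.Boundaryless`).

## References

* P. Topping, *Lectures on the Ricci flow*, LMS Lecture Note Series 325, CUP 2006, §8.3,
  Lemma 8.3.5 and its proof (Terms 1–4, (8.3.5)–(8.3.7)). [Topping2006]
* H. Federer, *Geometric Measure Theory*, Springer 1969, §2.10.11, §3.2.46. [Federer1969]
-/

noncomputable section

-- `Summit.SmoothPoincare4.SmoothPoincare4.…` (summit = problem) trips `dupNamespace` on every decl.
set_option linter.dupNamespace false

open scoped Manifold ContDiff ENNReal NNReal Topology
open Bundle MeasureTheory Set Filter Module Real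
open Literature.Geometry.Lorentzian Literature.Geometry.Riemannian

namespace Summit.SmoothPoincare4.SmoothPoincare4.Theorems.NoncompactShrinkerGapNoncollapsing

/-! ## The Riemannian measure charges open sets, for any model with corners -/

section Positivity

variable {E : Type*} [NormedAddCommGroup E] [NormedSpace ℝ E] [FiniteDimensional ℝ E]
  {H : Type*} [TopologicalSpace H] {I : ModelWithCorners ℝ E H} {n : ℕ∞ω}
  {N : Type*} [TopologicalSpace N] [ChartedSpace H N] [IsManifold I 1 N] [T3Space N]
  [MeasurableSpace N] [BorelSpace N]

/-- **The Riemannian measure charges nonempty open sets, for any model with corners**: for a `C^n`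
Riemannian metric `h` on a manifold modelled on `I : ModelWithCorners ℝ E H`, every nonempty open
`U` has `0 < riemannianVolume h (dim E) U`. As `riemannianVolume_pos_of_isOpen` (`VolumePositivity.lean`,
boundaryless case): a chart at `x ∈ U` is Lipschitz near `x` for the length distance
(`exists_enorm_extChartAt_sub_le_mul_riemannianEDist`), Lipschitz maps increase `μH[d]` at most by
a factor, and the chart image of a neighbourhood of `x` is a neighbourhood of the image point
WITHIN `range I` (`map_extChartAt_nhds`), which meets the interior of the (convex, with nonempty
interior) range (`ModelWithCorners.range_subset_closure_interior`) in a nonempty open subset of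
`E`, of positive `μH[dim E]` (an additive Haar measure). Federer 1969, §2.10.11 and §3.2.46.
[cite: Federer1969, §2.10.11 and §3.2.46] -/
theorem riemannianVolume_pos_of_isOpen_corners
    (h : ContMDiffRiemannianMetric I n E (TangentSpace I : N → Type _)) {U : Set N}
    (hU : IsOpen U) (hne : U.Nonempty) : 0 < riemannianVolume h (finrank ℝ E) U := by
  letI : RiemannianBundle (fun x : N ↦ TangentSpace I x) :=
    ⟨h.toContinuousRiemannianMetric.toRiemannianMetric⟩
  letI : EMetricSpace N := EMetricSpace.ofRiemannianMetric I N
  show 0 < (μHE[finrank ℝ E] : Measure N) U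
  rw [Measure.euclideanHausdorffMeasure_def, Measure.smul_apply, ENNReal.smul_def, smul_eq_mul]
  refine ENNReal.mul_pos
    (ENNReal.coe_ne_zero.2 (Measure.addHaarScalarFactor_volume_hausdorffMeasure_ne_zero _)) ?_
  -- a chart at `x ∈ U` is Lipschitz near `x` for the length distance
  obtain ⟨x, hx⟩ := hne
  obtain ⟨C, s, hs, hLip⟩ := exists_enorm_extChartAt_sub_le_mul_riemannianEDist (I := I) x
  have hL : LipschitzOnWith C (extChartAt I x) (s ∩ U) := by
    intro y hy z hz
    rw [edist_eq_enorm_sub]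
    exact hLip y hy.1 z hz.1
  letI : MeasurableSpace E := borel E
  haveI : BorelSpace E := ⟨rfl⟩
  have h1 := hL.hausdorffMeasure_image_le (d := finrank ℝ E) (Nat.cast_nonneg _)
  -- the chart image of the neighbourhood `s ∩ U` of `x` is a neighbourhood within `range I`
  have himg : extChartAt I x '' (s ∩ U) ∈ 𝓝[range I] (extChartAt I x x) := by
    rw [← map_extChartAt_nhds x]
    exact image_mem_map (inter_mem hs (hU.mem_nhds hx))
  obtain ⟨u, hu, hxu, huI⟩ := mem_nhdsWithin.1 himg
  -- `range I ⊆ closure (interior (range I))`: the open `u` meets the interior of the range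
  have hxr : extChartAt I x x ∈ closure (interior (range I)) :=
    I.range_subset_closure_interior (extChartAt_target_subset_range x (mem_extChartAt_target x))
  have hne' : (u ∩ interior (range I)).Nonempty := mem_closure_iff.1 hxr u hu hxu
  have h2 : 0 < (μH[finrank ℝ E] : Measure E) (u ∩ interior (range I)) :=
    (hu.inter isOpen_interior).measure_pos _ hne'
  have h3 : 0 < (μH[finrank ℝ E] : Measure E) (extChartAt I x '' (s ∩ U)) :=
    h2.trans_le (measure_mono ((inter_subset_inter_right u interior_subset).trans huI))
  have h4 : 0 < (μH[finrank ℝ E] : Measure N) (s ∩ U) :=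
    (ENNReal.mul_pos_iff.1 (h3.trans_le h1)).2
  exact (h4.trans_le (measure_mono inter_subset_right)).ne'

end Positivity

/-- **Geodesic balls of positive radius have positive volume**, for a Riemannian metric on a
manifold modelled on ANY model with corners (the tree's `PseudoRiemannianMetric.vol_ball_pos` needs a
boundaryless model and a compact manifold): balls are open (`isOpen_ball`) and contain their centre,
and the Riemannian measure charges open sets (`riemannianVolume_pos_of_isOpen_corners`). [folklore] -/
theorem vol_ball_pos_corners {E : Type*} [NormedAddCommGroup E] [NormedSpace ℝ E]
    [FiniteDimensional ℝ E] {H : Type*} [TopologicalSpace H] {I : ModelWithCorners ℝ E H}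
    {M : Type*} [TopologicalSpace M] [ChartedSpace H M] [IsManifold I ∞ M] [T3Space M]
    [MeasurableSpace M] [BorelSpace M]
    {G : PseudoRiemannianMetric I ∞ E (TangentSpace I : M → Type _)} (hG : G.IsRiemannian) (p : M)
    {r : ℝ≥0∞} (hr : 0 < r) : 0 < G.vol (G.ball p r) := by
  rw [PseudoRiemannianMetric.vol, PseudoRiemannianMetric.riemVolume_eq hG]
  exact riemannianVolume_pos_of_isOpen_corners (G.toContMDiffRiemannianMetric hG)
    (PseudoRiemannianMetric.isOpen_ball hG p r) ⟨p, PseudoRiemannianMetric.mem_ball_self p hr⟩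

/-- **Topping's Lemma 8.3.5 in compact-support form, on any manifold** (W4 of line
`collapsed-ends-usc`, corrected statement: with `|S|` integrable on `B(p, r)`). For `g` Riemannian,
`S` continuous, `τ, r > 0`, a smooth compactly supported `χ` with `0 ≤ χ ≤ 1`, `χ = 1` on
`B(p, r/2)`, `tsupport χ ⊆ B(p, r)`, `|∇χ|² ≤ K`, `Vol B(p, r) < ∞` and `|S| ∈ L¹(B(p, r))`:
`(∫ (τ (S χ² + 4|∇χ|²) − χ² log χ²))/Z + log Z + log (4πτ)^{-n/2} − n
  ≤ 4τK (V₁ − V₂)/V₂ + (τ/V₂) ∫_{B(p,r)} |S| + log (V₁/(4πτ)^{n/2}) − n`,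
`Z = ∫ χ²`, `V₁ = Vol B(p, r)`, `V₂ = Vol B(p, r/2)` (Terms 1–4 of the printed proof for the density
`χ²/Z`; Term 3 is Jensen's inequality `setIntegral_negMulLog_le_mul_log` on `B(p, r)` with mass `1`).
[cite: Topping2006, §8.3, proof of Lemma 8.3.5] -/
theorem helper_csEntropy_cutoff_le_of_integrableOn : ∀ {E : Type} [NormedAddCommGroup E] [NormedSpace ℝ E] [FiniteDimensional ℝ E] {H : Type} [TopologicalSpace H] (I : ModelWithCorners ℝ E H) (M : Type) [TopologicalSpace M] [T2Space M] [ChartedSpace H M] [IsManifold I ∞ M] [T3Space M] [MeasurableSpace M] [BorelSpace M] (g : PseudoRiemannianMetric I ∞ E (TangentSpace I : M → Type _)) (hg : g.IsRiemannian) (S : M → ℝ), Continuous S → ∀ (p : M) (r τ K : ℝ), 0 < r → 0 < τ → ∀ χ : M → ℝ, ContMDiff I 𝓘(ℝ, ℝ) ∞ χ → HasCompactSupport χ → (∀ x, 0 ≤ χ x) → (∀ x, χ x ≤ 1) → (∀ x ∈ g.ball p (ENNReal.ofReal (r / 2)), χ x = 1) → tsupport χ ⊆ g.ball p (ENNReal.ofReal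 r) → (∀ x, g.gradSq χ x ≤ K) → g.vol (g.ball p (ENNReal.ofReal r)) ≠ ⊤ → IntegrableOn (fun x ↦ |S x|) (g.ball p (ENNReal.ofReal r)) g.riemVolume → (∫ x, (τ * (S x * χ x ^ 2 + 4 * g.gradSq χ x) - χ x ^ 2 * Real.log (χ x ^ 2)) ∂g.riemVolume) / (∫ x, χ x ^ 2 ∂g.riemVolume) + Real.log (∫ x, χ x ^ 2 ∂g.riemVolume) + Real.log ((4 * Real.pi * τ) ^ (-(finrank ℝ E : ℝ) / 2)) - finrank ℝ E ≤ 4 * τ * K * ((((g.vol (g.ball p (ENNReal.ofReal r))).toReal - (g.vol (g.ball p (ENNReal.ofReal (r / 2)))).toReal)) / (g.vol (g.ball p (ENNReal.ofReal (r / 2)))).toReal) + τ / (g.vol (g.ball p (ENNReal.ofReal (r / 2)))).toReal * ∫ x in g.ball p (ENNReal.ofReal r), |S x| ∂g.riemVolume + Real.log ((g.vol (g.ball p (ENNReal.ofReal r))).toReal / (4 * Real.pi * τ) ^ ((finrank ℝ E : ℝ) / 2)) - finrank ℝ E := by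
  intro E _ _ _ H _ I M _ _ _ _ _ _ _ g hg S hS p r τ K hr hτ χ hχs hχcs hχ0 hχ1 hχB hχsupp hχK
    hV₁fin hSai
  classical
  -- the measure (finite on compact sets) and the balls
  haveI : IsFiniteMeasureOnCompacts g.riemVolume := by
    rw [PseudoRiemannianMetric.riemVolume_eq hg]
    exact ⟨fun K hK ↦ riemannianVolume_lt_top_of_isCompact_holds _ le_rfl hK⟩
  simp only [PseudoRiemannianMetric.vol] at hV₁fin ⊢
  set vol := g.riemVolume with hvol
  set B₁ := g.ball p (ENNReal.ofReal r) with hB₁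
  set B₂ := g.ball p (ENNReal.ofReal (r / 2)) with hB₂
  set V₁ : ℝ := (vol B₁).toReal with hV₁
  set V₂ : ℝ := (vol B₂).toReal with hV₂
  set n := finrank ℝ E with hn
  set Z : ℝ := ∫ x, χ x ^ 2 ∂vol with hZdef
  set J : ℝ := ∫ x in B₁, |S x| ∂vol with hJdef
  have hB₂B₁ : B₂ ⊆ B₁ := g.ball_mono p (ENNReal.ofReal_le_ofReal (by linarith))
  have hB₁o : IsOpen B₁ := PseudoRiemannianMetric.isOpen_ball hg p _
  have hB₂o : IsOpen B₂ := PseudoRiemannianMetric.isOpen_ball hg p _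
  have hB₁m : MeasurableSet B₁ := hB₁o.measurableSet
  have hB₂m : MeasurableSet B₂ := hB₂o.measurableSet
  have hB₁fin : vol B₁ ≠ ⊤ := hV₁fin
  have hB₁lt : vol B₁ < ⊤ := hB₁fin.lt_top
  have hB₂fin : vol B₂ ≠ ⊤ := ((measure_mono hB₂B₁).trans_lt hB₁lt).ne
  have hV₂pos : 0 < V₂ :=
    ENNReal.toReal_pos (vol_ball_pos_corners hg p (ENNReal.ofReal_pos.2 (half_pos hr))).ne' hB₂fin
  have hV₂V₁ : V₂ ≤ V₁ := ENNReal.toReal_mono hB₁fin (measure_mono hB₂B₁)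
  have hV₁pos : 0 < V₁ := hV₂pos.trans_le hV₂V₁
  have hdiff : (vol (B₁ \ B₂)).toReal = V₁ - V₂ := by
    rw [measure_sdiff hB₂B₁ hB₂m.nullMeasurableSet hB₂fin,
      ENNReal.toReal_sub_of_le (measure_mono hB₂B₁) hB₁fin]
  -- facts about `χ`
  have hχc : Continuous χ := hχs.continuous
  have hχ0' : ∀ x, x ∉ tsupport χ → χ x = 0 := fun x hx ↦ image_eq_zero_of_notMem_tsupport hx
  have hχ_out : ∀ x, x ∉ B₁ → χ x = 0 := fun x hx ↦ hχ0' x (fun h ↦ hx (hχsupp h))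
  have hχsq_le : ∀ x, χ x ^ 2 ≤ 1 := fun x ↦ by
    have := hχ1 x; have := hχ0 x; nlinarith
  have hgrad_out : ∀ x, x ∉ B₁ → g.gradSq χ x = 0 := fun x hx ↦
    g.gradSq_eq_zero_of_mvfderiv_eq_zero
      (mvfderiv_eq_zero_of_notMem_tsupport (fun h ↦ hx (hχsupp h)))
  have hgrad_in : ∀ x ∈ B₂, g.gradSq χ x = 0 := by
    intro x hx
    refine g.gradSq_eq_zero_of_mvfderiv_eq_zero ?_
    have hev : χ =ᶠ[𝓝 x] fun _ ↦ (1 : ℝ) := by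
      filter_upwards [hB₂o.mem_nhds hx] with y hy using hχB y hy
    have h0 : mfderiv I 𝓘(ℝ, ℝ) χ x = 0 := by
      rw [hev.mfderiv_eq]; exact mfderiv_const
    ext v
    simp [mvfderiv, h0]
  have hgrad_nn : ∀ x, 0 ≤ g.gradSq χ x := g.gradSq_nonneg hg χ
  have hK0 : 0 ≤ K := (hgrad_nn p).trans (hχK p)
  -- integrability of the continuous compactly supported integrands
  have intK : ∀ {F : M → ℝ}, Continuous F → (∀ x, x ∉ tsupport χ → F x = 0) →
      Integrable F vol := fun hF h0 ↦
    hF.integrable_of_hasCompactSupport (HasCompactSupport.intro hχcs h0)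
  have hχ2i : Integrable (fun x ↦ χ x ^ 2) vol :=
    intK (hχc.pow 2) (fun x hx ↦ by simp [hχ0' x hx])
  have hSχi : Integrable (fun x ↦ S x * χ x ^ 2) vol :=
    intK (hS.mul (hχc.pow 2)) (fun x hx ↦ by simp [hχ0' x hx])
  have hLi : Integrable (fun x ↦ χ x ^ 2 * Real.log (χ x ^ 2)) vol :=
    intK (Real.continuous_mul_log.comp (hχc.pow 2)) (fun x hx ↦ by simp [hχ0' x hx])
  -- `V₂ ≤ Z ≤ V₁`
  have hZV₂ : V₂ ≤ Z := by
    have h1 : ∫ x in B₂, (1 : ℝ) ∂vol ≤ ∫ x in B₂, χ x ^ 2 ∂vol :=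
      setIntegral_mono_on (integrableOn_const hB₂fin) hχ2i.integrableOn hB₂m
        (fun x hx ↦ by rw [hχB x hx]; norm_num)
    have h2 : ∫ x in B₂, χ x ^ 2 ∂vol ≤ ∫ x, χ x ^ 2 ∂vol :=
      setIntegral_le_integral hχ2i (Eventually.of_forall fun x ↦ sq_nonneg _)
    have h3 : ∫ x in B₂, (1 : ℝ) ∂vol = V₂ := by
      rw [setIntegral_const, smul_eq_mul, mul_one]; rfl
    linarith
  have hZpos : 0 < Z := hV₂pos.trans_le hZV₂
  have hZV₁ : Z ≤ V₁ := by
    have h0 : ∀ x, x ∉ B₁ → χ x ^ 2 = 0 := fun x hx ↦ by simp [hχ_out x hx]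
    rw [hZdef, ← setIntegral_eq_integral_of_forall_compl_eq_zero h0]
    calc ∫ x in B₁, χ x ^ 2 ∂vol ≤ ‖∫ x in B₁, χ x ^ 2 ∂vol‖ := Real.le_norm_self _
      _ ≤ 1 * vol.real B₁ := norm_setIntegral_le_of_norm_le_const hB₁lt (fun x _ ↦ by
          rw [Real.norm_eq_abs, abs_of_nonneg (sq_nonneg _)]; exact hχsq_le x)
      _ = V₁ := by rw [one_mul, measureReal_def]
  -- Term 1: `∫ |∇χ|² ≤ K (V₁ - V₂)`
  have hIG : ∫ x, g.gradSq χ x ∂vol ≤ K * (V₁ - V₂) := by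
    have hG0 : ∀ x, x ∉ B₁ \ B₂ → g.gradSq χ x = 0 := by
      intro x hx
      by_cases h1 : x ∈ B₁
      · have h2 : x ∈ B₂ := by
          by_contra h2; exact hx ⟨h1, h2⟩
        exact hgrad_in x h2
      · exact hgrad_out x h1
    rw [← setIntegral_eq_integral_of_forall_compl_eq_zero hG0]
    have hGle : ∀ x ∈ B₁ \ B₂, ‖g.gradSq χ x‖ ≤ K := fun x _ ↦ by
      rw [Real.norm_eq_abs, abs_of_nonneg (hgrad_nn x)]; exact hχK x
    calc ∫ x in B₁ \ B₂, g.gradSq χ x ∂vol ≤ ‖∫ x in B₁ \ B₂, g.gradSq χ x ∂vol‖ :=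
          Real.le_norm_self _
      _ ≤ K * vol.real (B₁ \ B₂) :=
          norm_setIntegral_le_of_norm_le_const ((measure_mono Set.sdiff_subset).trans_lt hB₁lt) hGle
      _ = K * (V₁ - V₂) := by rw [measureReal_def, hdiff]
  have hIG0 : 0 ≤ ∫ x, g.gradSq χ x ∂vol := integral_nonneg hgrad_nn
  -- Term 2: `∫ S χ² ≤ ∫_{B₁} |S|`
  have hIS : ∫ x, S x * χ x ^ 2 ∂vol ≤ J := by
    have h0 : ∀ x, x ∉ B₁ → S x * χ x ^ 2 = 0 := fun x hx ↦ by simp [hχ_out x hx]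
    rw [← setIntegral_eq_integral_of_forall_compl_eq_zero h0]
    refine setIntegral_mono hSχi.integrableOn hSai (fun x ↦ ?_)
    calc S x * χ x ^ 2 ≤ |S x| * χ x ^ 2 := by gcongr; exact le_abs_self _
      _ ≤ |S x| := mul_le_of_le_one_right (abs_nonneg _) (hχsq_le x)
  have hJ0 : 0 ≤ J := setIntegral_nonneg hB₁m (fun x _ ↦ abs_nonneg _)
  -- Term 3: Jensen's inequality for the density `σ = χ²/Z`, supported in `B₁`
  set σ : M → ℝ := fun x ↦ χ x ^ 2 / Z with hσ
  have hσnn : ∀ x, 0 ≤ σ x := fun x ↦ by simp only [hσ]; positivity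
  have hσc : Continuous σ := by rw [hσ]; exact (hχc.pow 2).div_const Z
  have hσi : Integrable σ vol := by rw [hσ]; exact hχ2i.div_const Z
  have hσ_out : ∀ x, x ∉ B₁ → σ x = 0 := fun x hx ↦ by simp [hσ, hχ_out x hx]
  have hσint : ∫ x in B₁, σ x ∂vol = 1 := by
    rw [setIntegral_eq_integral_of_forall_compl_eq_zero hσ_out]
    simp only [hσ]
    rw [integral_div, ← hZdef, div_self hZpos.ne']
  have hnegc : Continuous fun x ↦ negMulLog (σ x) := continuous_negMulLog.comp hσc
  have hnegi : Integrable (fun x ↦ negMulLog (σ x)) vol :=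
    intK hnegc (fun x hx ↦ by simp [hσ, hχ0' x hx, negMulLog_zero])
  have hneg_out : ∀ x, x ∉ B₁ → negMulLog (σ x) = 0 := fun x hx ↦ by
    rw [hσ_out x hx, negMulLog_zero]
  have hJensen : ∫ x, negMulLog (σ x) ∂vol ≤ Real.log V₁ := by
    rw [← setIntegral_eq_integral_of_forall_compl_eq_zero hneg_out]
    have hB0 : vol B₁ ≠ 0 := (vol_ball_pos_corners hg p (ENNReal.ofReal_pos.2 hr)).ne'
    have h := setIntegral_negMulLog_le_mul_log hB0 hB₁fin
      (Eventually.of_forall fun x ↦ hσnn x) hσi.integrableOn one_pos hσint hnegi.integrableOn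
    rwa [one_mul, div_one, measureReal_def, ← hV₁] at h
  have hnegMulLog_eq : ∀ x, negMulLog (σ x) =
      -Z⁻¹ * (χ x ^ 2 * Real.log (χ x ^ 2)) + Z⁻¹ * Real.log Z * χ x ^ 2 := by
    intro x
    simp only [hσ]
    rw [negMulLog]
    by_cases hx : χ x = 0
    · simp [hx]
    · rw [Real.log_div (pow_ne_zero 2 hx) hZpos.ne', div_eq_mul_inv]
      ring
  have hI3 : ∫ x, negMulLog (σ x) ∂vol =
      -(∫ x, χ x ^ 2 * Real.log (χ x ^ 2) ∂vol) / Z + Real.log Z := by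
    rw [show (fun x ↦ negMulLog (σ x)) =
        fun x ↦ -Z⁻¹ * (χ x ^ 2 * Real.log (χ x ^ 2)) + Z⁻¹ * Real.log Z * χ x ^ 2 from
      funext hnegMulLog_eq, integral_add (hLi.const_mul _) (hχ2i.const_mul _),
      integral_const_mul, integral_const_mul, ← hZdef]
    field_simp
  have h3 : -(∫ x, χ x ^ 2 * Real.log (χ x ^ 2) ∂vol) / Z + Real.log Z ≤ Real.log V₁ := by
    have := hJensen; rwa [hI3] at this
  -- Term 4: the normalisation constants
  set D : ℝ := (4 * Real.pi * τ) ^ ((n : ℝ) / 2) with hD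
  have h4πτ : 0 < 4 * Real.pi * τ := by positivity
  have hDpos : 0 < D := Real.rpow_pos_of_pos h4πτ _
  have hlogA : Real.log ((4 * Real.pi * τ) ^ (-(n : ℝ) / 2)) = -Real.log D := by
    rw [hD, Real.log_rpow h4πτ, Real.log_rpow h4πτ]; ring
  have hlogV₁D : Real.log (V₁ / D) = Real.log V₁ - Real.log D :=
    Real.log_div hV₁pos.ne' hDpos.ne'
  -- the numerator, divided by `Z ≥ V₂`
  have hmain : (∫ x, (τ * (S x * χ x ^ 2 + 4 * g.gradSq χ x) - χ x ^ 2 * Real.log (χ x ^ 2)) ∂vol) / Z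
      + Real.log Z ≤ 4 * τ * K * ((V₁ - V₂) / V₂) + τ / V₂ * J + Real.log V₁ := by
    have ht1 : 0 ≤ 4 * τ * K * ((V₁ - V₂) / V₂) := by
      have : 0 ≤ V₁ - V₂ := by linarith
      positivity
    have ht2 : 0 ≤ τ / V₂ * J := by positivity
    by_cases hFi : Integrable (fun x ↦ τ * (S x * χ x ^ 2 + 4 * g.gradSq χ x)
        - χ x ^ 2 * Real.log (χ x ^ 2)) vol
    · -- the gradient square is then integrable, and the numerator splits into Terms 1–3
      have h4τ : (4 * τ) ≠ 0 := by positivity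
      have hGi : Integrable (fun x ↦ g.gradSq χ x) vol := by
        refine (((hFi.add hLi).sub (hSχi.const_mul τ)).div_const (4 * τ)).congr
          (Eventually.of_forall fun x ↦ ?_)
        simp only [Pi.add_apply, Pi.sub_apply]
        rw [div_eq_iff h4τ]
        ring
      have hsplit : ∫ x, (τ * (S x * χ x ^ 2 + 4 * g.gradSq χ x) - χ x ^ 2 * Real.log (χ x ^ 2)) ∂vol
          = τ * (∫ x, S x * χ x ^ 2 ∂vol) + 4 * τ * (∫ x, g.gradSq χ x ∂vol)
            - ∫ x, χ x ^ 2 * Real.log (χ x ^ 2) ∂vol := by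
        have hI : Integrable (fun x ↦ τ * (S x * χ x ^ 2 + 4 * g.gradSq χ x)) vol :=
          (hSχi.add (hGi.const_mul 4)).const_mul τ
        rw [integral_sub hI hLi, integral_const_mul, integral_add hSχi (hGi.const_mul 4),
          integral_const_mul]
        ring
      have h1 : τ * (∫ x, S x * χ x ^ 2 ∂vol) / Z ≤ τ / V₂ * J := by
        have ha : τ * (∫ x, S x * χ x ^ 2 ∂vol) / Z ≤ τ * J / Z :=
          div_le_div_of_nonneg_right (mul_le_mul_of_nonneg_left hIS hτ.le) hZpos.le
        have hb : τ * J / Z ≤ τ * J / V₂ :=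
          div_le_div_of_nonneg_left (by positivity) hV₂pos hZV₂
        calc _ ≤ τ * J / Z := ha
          _ ≤ τ * J / V₂ := hb
          _ = τ / V₂ * J := by ring
      have h2 : 4 * τ * (∫ x, g.gradSq χ x ∂vol) / Z ≤ 4 * τ * K * ((V₁ - V₂) / V₂) := by
        have ha : 4 * τ * (∫ x, g.gradSq χ x ∂vol) / Z ≤ 4 * τ * (∫ x, g.gradSq χ x ∂vol) / V₂ :=
          div_le_div_of_nonneg_left (by positivity) hV₂pos hZV₂
        have hb : 4 * τ * (∫ x, g.gradSq χ x ∂vol) / V₂ ≤ 4 * τ * (K * (V₁ - V₂)) / V₂ :=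
          div_le_div_of_nonneg_right (mul_le_mul_of_nonneg_left hIG (by positivity)) hV₂pos.le
        calc _ ≤ 4 * τ * (∫ x, g.gradSq χ x ∂vol) / V₂ := ha
          _ ≤ 4 * τ * (K * (V₁ - V₂)) / V₂ := hb
          _ = 4 * τ * K * ((V₁ - V₂) / V₂) := by ring
      have hexp : (τ * (∫ x, S x * χ x ^ 2 ∂vol) + 4 * τ * (∫ x, g.gradSq χ x ∂vol)
            - ∫ x, χ x ^ 2 * Real.log (χ x ^ 2) ∂vol) / Z
          = τ * (∫ x, S x * χ x ^ 2 ∂vol) / Z + 4 * τ * (∫ x, g.gradSq χ x ∂vol) / Z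
            + -(∫ x, χ x ^ 2 * Real.log (χ x ^ 2) ∂vol) / Z := by ring
      rw [hsplit, hexp]
      linarith
    · -- otherwise the Bochner integral of the numerator vanishes
      rw [integral_undef hFi, zero_div, zero_add]
      have hlogZ : Real.log Z ≤ Real.log V₁ := Real.log_le_log hZpos hZV₁
      linarith
  -- conclusion
  rw [hlogA, hlogV₁D]
  linarith [hmain]

end Summit.SmoothPoincare4.SmoothPoincare4.Theorems.NoncompactShrinkerGapNoncollapsing

end
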